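import Literature.AlgebraicTopology.Homotopy.SerreFibrationCube
import Literature.AlgebraicTopology.Homotopy.SerreCellsDirectSum
import HarnessLib

/-!
# Serre fibrations over one cell of a CW complex: `H_{k+s}(p⁻¹ē, p⁻¹ė)` against `H_k` of the fibre

Topic `Literature/AlgebraicTopology/Homotopy`. E. H. Spanier, *Algebraic Topology* (1981), Ch. 9,
Sec. 2, Thm. 15 (a) ("`ψ_* : H_s(e, ė; Hₙ(F)) ≈ H_{n+s}(p⁻¹(e), p⁻¹(ė))`", proved there from a
local trivialisation) — here for SERRE fibrations and in the naturality form needed for the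
comparison theorems: for a Hausdorff CW complex `X`, an `s`-cell `eⱼ` with characteristic map
`Φⱼ`, Serre fibrations `p : E → X`, `p' : E' → X` and a fibrewise map `f : E → E'`
(`p' ∘ f = p`), with `(p⁻¹ēⱼ, p⁻¹ėⱼ) = (Cl p j, fr p j)` the pieces of the cellular filtration
(`FibreBundlesCellsDirectSum.lean`) and `Fⱼ = p⁻¹(Φⱼ 0)` the fibre over the centre of the cell:

* `SerreCell.isZero_of_lt` — `H_n(p⁻¹ēⱼ, p⁻¹ėⱼ; R) = 0` for `n < s`;
* `SerreCell.isIso_map_iff`, `epi_map_iff`, `mono_map_iff` — **`f_* : H_{k+s}(p⁻¹ēⱼ, p⁻¹ėⱼ) →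
  H_{k+s}(p'⁻¹ēⱼ, p'⁻¹ėⱼ)` is an isomorphism (onto, injective) iff `f_* : H_k(Fⱼ) → H_k(F'ⱼ)` is.**

Proof: pull `p` back along `Φⱼ` restricted to the closed ball of radius `¾` (a Serre fibration
over a cube, `IsSerreFibration.pullback_fst`), to which `SerreFibrationCube.lean` applies; the
projection of pairs `(Q, Q|_{‖y‖ = ¾}) → (p⁻¹ēⱼ, p⁻¹(ēⱼ ∩ collar))` is an isomorphism on relative
homology (the annulus `½ ≤ ‖y‖ ≤ ¾` retracts onto the sphere `‖y‖ = ¾`; `Q ≅ p⁻¹Φⱼ(‖y‖ ≤ ¾)`;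
excision of `p⁻¹(ēⱼ ∖ Φⱼ(‖y‖ ≤ ¾))`, Spanier's Lemma 9.2.2 proof), and so is
`H(p⁻¹ēⱼ, p⁻¹ėⱼ) → H(p⁻¹ēⱼ, p⁻¹(ēⱼ ∩ collar))` (`CellsDirectSum.Serre.isIso_b`); the fibre
`Fⱼ` includes into `Q` by a weak equivalence. Everything is proved; no named facts.

## References

* E. H. Spanier, *Algebraic Topology*, Springer (1981), Ch. 9, Sec. 2, Lemma 2, Thm. 15 (a),
  Thm. 17. [Spanier1981]
* A. Hatcher, *Algebraic Topology*, CUP (2002), §4.2 p. 376, p. 406 (pullbacks); Thm. 2.20.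
  [HatcherAT2002]
-/

noncomputable section

open Set Function Metric unitInterval CategoryTheory CategoryTheory.Limits
open scoped Topology unitInterval Topology.Homotopy
open Literature.AlgebraicTopology.SingularHomology

namespace Literature.AlgebraicTopology.Homotopy

universe u u' v uR

/-! ### Pullbacks of Serre fibrations -/

/-- **The pullback of a Serre fibration is a Serre fibration** (Hatcher 2002, p. 406: "pullbacks
of fibrations are fibrations"; the relative cube lifting is inherited by lifting the second
component). [cite: HatcherAT2002, §4.2 p. 406] -/
theorem IsSerreFibration.pullback_fst {E : Type u} {B : Type v} {B' : Type u'} [TopologicalSpace E]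
    [TopologicalSpace B] [TopologicalSpace B'] {p : E → B} (hp : IsSerreFibration p) (g : C(B', B)) :
    IsSerreFibration (Function.Pullback.fst : (⇑g).Pullback p → B') := by
  refine ⟨continuous_fst.comp continuous_subtype_val, fun k K g₀ hg₀ hg₀K => ?_⟩
  obtain ⟨G, hGK, hGg⟩ := hp.exists_homotopy_lift_rel (g.comp K) (fun z => (g₀ z).snd)
    ((continuous_snd.comp continuous_subtype_val).comp_continuousOn hg₀) (fun z hz => by
      show p (g₀ z).snd = g (K z)
      rw [← hg₀K z hz]
      exact (g₀ z).2.symm)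
  refine ⟨⟨fun z => ⟨(K z, G z), (hGK z).symm⟩,
    (K.continuous.prodMk G.continuous).subtype_mk _⟩, fun z => rfl, fun z hz => ?_⟩
  apply Subtype.ext
  apply Prod.ext
  · exact (hg₀K z hz).symm
  · exact hGg z hz

namespace SerreCell

open _root_.Topology RelCWComplex SkeletonCollar CellsDirectSum

variable {X : Type v} [TopologicalSpace X] [T2Space X] [CWComplex (univ : Set X)] {s : ℕ}

/-! ### The characteristic map on a closed ball of radius `r ≤ 1` -/

/-- `Φⱼ` restricted to the closed ball of radius `r ≤ 1`, a continuous map. [folklore] -/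
def cellChar (j : cell (univ : Set X) s) {r : ℝ} (hr : r ≤ 1) : C(↥(closedBall (0 : Fin s → ℝ) r), X) :=
  ⟨(closedBall (0 : Fin s → ℝ) r).restrict (map s j),
    ((continuousOn s j).mono (closedBall_subset_closedBall hr)).restrict⟩

omit [T2Space X] in
/-- The formula for `cellChar`. [folklore] -/
@[simp] theorem cellChar_apply (j : cell (univ : Set X) s) {r : ℝ} (hr : r ≤ 1) (y : ↥(closedBall (0 : Fin s → ℝ) r)) :
    cellChar j hr y = map s j y := rfl

omit [T2Space X] in
/-- For `r < 1`, `Φⱼ` is injective on the closed ball of radius `r`. [folklore] -/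
theorem injOn_closedBall (j : cell (univ : Set X) s) {r : ℝ} (hr : r < 1) :
    InjOn (map s j) (closedBall (0 : Fin s → ℝ) r) :=
  (map_injOn j).mono (closedBall_subset_ball hr)

/-- **`Φⱼ` is a homeomorphism of the closed ball of radius `r < 1` onto its image** (a continuous
injection of a compact space into a Hausdorff space). [folklore] -/
def ballImageHomeomorph (j : cell (univ : Set X) s) {r : ℝ} (hr : r < 1) :
    ↥(closedBall (0 : Fin s → ℝ) r) ≃ₜ ↥(map s j '' closedBall (0 : Fin s → ℝ) r) :=
  haveI : CompactSpace ↥(closedBall (0 : Fin s → ℝ) r) := isCompact_iff_compactSpace.1 (isCompact_closedBall _ _)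
  Continuous.homeoOfEquivCompactToT2 (f := Equiv.Set.imageOfInjOn (map s j) _ (injOn_closedBall j hr))
    ((cellChar j hr.le).continuous.subtype_mk _)

/-- The formula for `ballImageHomeomorph`. [folklore] -/
@[simp] theorem ballImageHomeomorph_apply_coe (j : cell (univ : Set X) s) {r : ℝ} (hr : r < 1)
    (y : ↥(closedBall (0 : Fin s → ℝ) r)) : (ballImageHomeomorph j hr y : X) = map s j y := rfl

/-- `Φⱼ (ballImageHomeomorph⁻¹ x) = x`. [folklore] -/
theorem map_ballImageHomeomorph_symm (j : cell (univ : Set X) s) {r : ℝ} (hr : r < 1)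
    (x : ↥(map s j '' closedBall (0 : Fin s → ℝ) r)) :
    map s j ((ballImageHomeomorph j hr).symm x : Fin s → ℝ) = x := by
  conv_rhs => rw [← (ballImageHomeomorph j hr).apply_symm_apply x]
  rfl

/-- A point `Φⱼ y`, `‖y‖ < 1`, of the open cell is `Φⱼ y'` with `‖y'‖ ≤ 1` only for `y' = y`.
[folklore] -/
theorem eq_of_map_eq_map_of_norm_lt {j : cell (univ : Set X) s} {y y' : Fin s → ℝ} (hy : ‖y‖ < 1)
    (hy' : ‖y'‖ ≤ 1) (h : map s j y' = map s j y) : y' = y := by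
  rcases hy'.lt_or_eq with h1 | h1
  · exact map_injOn j (mem_ball_zero_iff.2 h1) (mem_ball_zero_iff.2 hy) h
  · exfalso
    exact Set.disjoint_left.1 (disjoint_cellFrontier_openCell j) (map_mem_cellFrontier j h1)
      (h ▸ map_mem_openCell j (mem_ball_zero_iff.2 hy))

/-! ### The pullback `Q` of `p` over the closed ball of radius `¾`, a Serre fibration over a cube -/

section Pullback

variable {E : Type u} [TopologicalSpace E] {p : E → X} (j : cell (univ : Set X) s)

/-- The radius `¾`. [folklore] -/
abbrev rad : ℝ := 3 / 4

/-- `0 < ¾`. [folklore] -/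
theorem rad_pos : (0 : ℝ) < rad := by norm_num
/-- `¾ < 1`. [folklore] -/
theorem rad_lt_one : rad < 1 := by norm_num
/-- `¾ ≤ 1`. [folklore] -/
theorem rad_le_one : rad ≤ 1 := rad_lt_one.le
/-- `½ ≤ ¾`. [folklore] -/
theorem half_le_rad : (2⁻¹ : ℝ) ≤ rad := by norm_num

/-- `Q = Φⱼ|_{‖y‖ ≤ ¾}^* E`, the pullback of `p`. [cite: HatcherAT2002, §4.2 p. 406] -/
abbrev Q (p : E → X) (j : cell (univ : Set X) s) : Type u := (⇑(cellChar j rad_le_one)).Pullback p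

/-- `Q → I^s`: the first projection followed by `(‖y‖ ≤ ¾) ≅ (‖y‖ ≤ 1) ≅ Iˢ`. [folklore] -/
def qmap (p : E → X) (j : cell (univ : Set X) s) : Q p j → (Fin s → I) :=
  fun z => closedBallHomeomorphCube s (closedBallScaleHomeomorph rad_pos z.fst)

omit [T2Space X] in
/-- `Q → Iˢ` is a Serre fibration. [cite: HatcherAT2002, §4.2 p. 376, p. 406] -/
theorem isSerreFibration_qmap (hp : IsSerreFibration p) : IsSerreFibration (qmap p j) :=
  ((hp.pullback_fst (cellChar j rad_le_one)).homeomorph_comp (closedBallScaleHomeomorph rad_pos)).homeomorph_comp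
    (closedBallHomeomorphCube s)

/-- `Q|_{‖y‖ = ¾}`, the part of `Q` over the boundary sphere. [folklore] -/
abbrev QS (p : E → X) (j : cell (univ : Set X) s) : Set (Q p j) :=
  Function.Pullback.fst ⁻¹' (Subtype.val ⁻¹' sphere (0 : Fin s → ℝ) rad)

/-- `Q|_{½ ≤ ‖y‖ ≤ ¾}`, the part of `Q` over the annulus. [folklore] -/
abbrev QA (p : E → X) (j : cell (univ : Set X) s) : Set (Q p j) :=
  Function.Pullback.fst ⁻¹' (Subtype.val ⁻¹' annulus 2⁻¹ rad)

omit [T2Space X] [TopologicalSpace E] in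
/-- `qmap⁻¹ ∂Iˢ = Q|_{‖y‖ = ¾}`. [folklore] -/
theorem qmap_preimage_boundary : qmap p j ⁻¹' Cube.boundary (Fin s) = QS p j := by
  ext z
  show closedBallHomeomorphCube s (closedBallScaleHomeomorph rad_pos z.fst) ∈ Cube.boundary (Fin s) ↔
    z.fst ∈ Subtype.val ⁻¹' sphere (0 : Fin s → ℝ) rad
  rw [← norm_eq_one_iff_closedBallHomeomorphCube_mem_boundary, ← mem_sphere_zero_iff_norm]
  constructor
  · intro h
    have := mapsTo_closedBallScaleHomeomorph_symm (E := Fin s → ℝ) rad_pos h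
    rwa [Homeomorph.symm_apply_apply] at this
  · intro h
    exact mapsTo_closedBallScaleHomeomorph (E := Fin s → ℝ) rad_pos h

omit [T2Space X] [TopologicalSpace E] in
/-- `Q|_{‖y‖ = ¾} ⊆ Q|_{½ ≤ ‖y‖ ≤ ¾}`. [folklore] -/
theorem QS_subset_QA : QS p j ⊆ QA p j := fun _ hz =>
  sphere_subset_annulus (E := Fin s → ℝ) half_le_rad hz

omit [T2Space X] in
/-- **`H_n(Q, Q|_{‖y‖=¾}) ≅ H_n(Q, Q|_{½≤‖y‖≤¾})`**: the annulus retracts onto its outer sphere, a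
weak equivalence of sub-bases. [cite: Spanier1981, Ch. 9, Sec. 2, Thm. 17] -/
theorem isIso_map_QS_QA (hp : IsSerreFibration p) (R : Type uR) [CommRing R] (n : ℕ) :
    IsIso (relativeSingularHomology.map R R (ContinuousMap.id (Q p j)) (mapsTo_id_of_subset (QS_subset_QA (p := p) j)) n) := by
  have hfst := hp.pullback_fst (cellChar j rad_le_one)
  refine relativeSingularHomology.isIso_map_of_isZero R R (QS_subset_QA (p := p) j) (fun i => ?_) n
  -- the weak equivalence `sphere ↪ annulus`, read on the subtype `‖y‖ ≤ ¾`
  have hsub : (Subtype.val ⁻¹' sphere (0 : Fin s → ℝ) rad : Set ↥(closedBall (0 : Fin s → ℝ) rad)) ⊆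
      Subtype.val ⁻¹' annulus 2⁻¹ rad := fun _ hz => sphere_subset_annulus (E := Fin s → ℝ) half_le_rad hz
  have hw : IsWeakHomotopyEquiv (subsetInclusion hsub) := by
    have h0 := isWeakHomotopyEquiv_subsetInclusion_of_isStrongDeformationRetractOf
      (isStrongDeformationRetractOf_sphere_annulus (E := Fin s → ℝ) (a := 2⁻¹) (b := rad) (by norm_num) half_le_rad)
      (sphere_subset_annulus (E := Fin s → ℝ) half_le_rad)
    let eS := preimageValHomeomorphOfSubset (sphere_subset_closedBall : sphere (0 : Fin s → ℝ) rad ⊆ closedBall 0 rad)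
    let eA := preimageValHomeomorphOfSubset (annulus_subset_closedBall (E := Fin s → ℝ) 2⁻¹ rad)
    have hfac : subsetInclusion hsub = ((eA.symm : C(_, _)).comp
        (subsetInclusion (sphere_subset_annulus (E := Fin s → ℝ) half_le_rad))).comp (eS : C(_, _)) := by
      ext z; rfl
    rw [hfac]
    exact ((IsWeakHomotopyEquiv.of_homeomorph eA.symm).comp h0).comp (IsWeakHomotopyEquiv.of_homeomorph eS)
  exact hfst.isZero_relativeSingularHomology_preimage hsub hw R i

/-! ### The projection of pairs `(Q, Q|_{‖y‖=¾}) → (p⁻¹ēⱼ, p⁻¹(ēⱼ ∩ collar))` -/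

omit [T2Space X] [TopologicalSpace E] in
/-- A point `(y, e)` of `Q` lies over `Φⱼ y`. [folklore] -/
theorem apply_snd (z : Q p j) : p z.snd = map s j z.fst := z.2.symm

omit [T2Space X] [TopologicalSpace E] in
/-- A point of `Q` lies over the closed cell. [folklore] -/
theorem snd_mem_closedCell (z : Q p j) : p z.snd ∈ closedCell s j := by
  rw [apply_snd j z]
  exact map_mem_closedCell j (closedBall_subset_closedBall rad_le_one z.fst.2)

/-- **The projection `Π : Q → p⁻¹ēⱼ`**, `(y, e) ↦ e`. [folklore] -/
def proj (p : E → X) (j : cell (univ : Set X) s) : C(Q p j, Cl p j) :=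
  ⟨fun z => ⟨z.snd, snd_mem_closedCell j z⟩, (continuous_snd.comp continuous_subtype_val).subtype_mk _⟩

omit [TopologicalSpace E] in
/-- A point of `Q` over `½ ≤ ‖y‖` lies over `ēⱼ ∩ collar`. [folklore] -/
theorem snd_mem_collar {z : Q p j} (hz : 2⁻¹ ≤ ‖(z.fst : Fin s → ℝ)‖) : p z.snd ∈ closedCell s j ∩ collar s := by
  rw [closedCell_inter_collar, apply_snd j z]
  exact Or.inr ⟨z.fst, ⟨hz, (mem_closedBall_zero_iff.1 z.fst.2).trans rad_le_one⟩, rfl⟩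

/-- `Π` maps `Q|_{‖y‖=¾}` into `p⁻¹(ēⱼ ∩ collar)`. [folklore] -/
theorem mapsTo_proj_QS : MapsTo (proj p j) (QS p j) (an p j) := fun z hz =>
  ⟨snd_mem_closedCell j z, (snd_mem_collar j (by
    have h : ‖(z.fst : Fin s → ℝ)‖ = rad := mem_sphere_zero_iff_norm.1 hz
    rw [h]; exact half_le_rad)).2⟩

/-- `Π` maps `Q|_{½≤‖y‖≤¾}` into `p⁻¹(ēⱼ ∩ collar)`. [folklore] -/
theorem mapsTo_proj_QA : MapsTo (proj p j) (QA p j) (an p j) := fun z hz =>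
  ⟨snd_mem_closedCell j z, (snd_mem_collar j hz.1).2⟩

/-- The subset `T = p⁻¹Φⱼ(‖y‖ ≤ ¾)` of `p⁻¹ēⱼ`. [folklore] -/
def T (p : E → X) (j : cell (univ : Set X) s) : Set (Cl p j) :=
  {w | p w.1 ∈ map s j '' closedBall (0 : Fin s → ℝ) rad}

/-- **`Q ≅ p⁻¹Φⱼ(‖y‖ ≤ ¾)`** (`Φⱼ` is an embedding on the ball of radius `¾`). [folklore] -/
def homeoT (hp : IsSerreFibration p) : Q p j ≃ₜ ↥(T p j) where
  toFun z := ⟨proj p j z, ⟨z.fst, z.fst.2, z.2⟩⟩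
  invFun w := ⟨((ballImageHomeomorph j rad_lt_one).symm ⟨p w.1.1, w.2⟩, w.1.1),
    map_ballImageHomeomorph_symm j rad_lt_one ⟨p w.1.1, w.2⟩⟩
  left_inv z := by
    apply Subtype.ext
    apply Prod.ext
    · show (ballImageHomeomorph j rad_lt_one).symm ⟨p z.snd, _⟩ = z.fst
      rw [Homeomorph.symm_apply_eq]
      exact Subtype.ext z.2.symm
    · rfl
  right_inv w := rfl
  continuous_toFun := (proj p j).continuous.subtype_mk _
  continuous_invFun := by
    refine Continuous.subtype_mk (Continuous.prodMk ?_ ?_) _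
    · exact (ballImageHomeomorph j rad_lt_one).symm.continuous.comp
        (((hp.continuous.comp continuous_subtype_val).comp continuous_subtype_val).subtype_mk _)
    · exact continuous_subtype_val.comp continuous_subtype_val

/-- `homeoT` carries `Q|_{½≤‖y‖≤¾}` into `T ∩ p⁻¹(ēⱼ ∩ collar)`. [folklore] -/
theorem mapsTo_homeoT (hp : IsSerreFibration p) :
    MapsTo (homeoT j hp) (QA p j) (Subtype.val ⁻¹' an p j) := fun _ hz => mapsTo_proj_QA j hz

/-- … and back. [folklore] -/
theorem mapsTo_homeoT_symm (hp : IsSerreFibration p) :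
    MapsTo (homeoT j hp).symm (Subtype.val ⁻¹' an p j) (QA p j) := by
  intro w hw
  -- `p w = Φⱼ y₀` with `‖y₀‖ ≤ ¾`; membership in the collar forces `½ ≤ ‖y₀‖`
  set y₀ := (ballImageHomeomorph j rad_lt_one).symm ⟨p w.1.1, w.2⟩ with hy₀
  have hpy : map s j (y₀ : Fin s → ℝ) = p w.1.1 := map_ballImageHomeomorph_symm j rad_lt_one ⟨p w.1.1, w.2⟩
  have hy₀r : ‖(y₀ : Fin s → ℝ)‖ ≤ rad := mem_closedBall_zero_iff.1 y₀.2
  have hcol : p w.1.1 ∈ closedCell s j ∩ collar s := hw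
  rw [closedCell_inter_collar] at hcol
  refine ⟨?_, hy₀r⟩
  show 2⁻¹ ≤ ‖(y₀ : Fin s → ℝ)‖
  rcases hcol with h | ⟨y, ⟨hy1, hy2⟩, hy⟩
  · exfalso
    rw [← hpy] at h
    exact Set.disjoint_left.1 (disjoint_cellFrontier_openCell j) h
      (map_mem_openCell j (mem_ball_zero_iff.2 (hy₀r.trans_lt rad_lt_one)))
  · rw [← hpy] at hy
    rw [← eq_of_map_eq_map_of_norm_lt (hy₀r.trans_lt rad_lt_one) hy2 hy]
    exact hy1

/-- **Excision: `H_n(T, T ∩ p⁻¹(ēⱼ ∩ collar)) ≅ H_n(p⁻¹ēⱼ, p⁻¹(ēⱼ ∩ collar))`.** The interiors of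
`T ⊇ p⁻¹Φⱼ(‖y‖ < ¾)` and of `p⁻¹(ēⱼ ∩ collar) ⊇ p⁻¹(ēⱼ ∖ Φⱼ(‖y‖ ≤ ½))` cover `p⁻¹ēⱼ`.
[cite: Spanier1981, Ch. 9, Sec. 2, Lemma 2 (proof); HatcherAT2002, Thm. 2.20] -/
theorem isIso_exc (hp : IsSerreFibration p) (R : Type uR) [CommRing R] (n : ℕ) :
    IsIso (relativeSingularHomology.map R R (subsetIncl (T p j))
      (Set.mapsTo_preimage Subtype.val (an p j) : MapsTo _ (Subtype.val ⁻¹' an p j) (an p j)) n) := by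
  refine relativeSingularHomology.isIso_map_of_interior_union_interior_holds R R (Cl p j) (an p j) (T p j) ?_ n
  have hpc : Continuous fun w : Cl p j => p w.1 := hp.continuous.comp continuous_subtype_val
  -- two open subsets of the closed cell
  have hK1 : IsCompact (map s j '' annulus rad 1 : Set X) :=
    ((isCompact_closedBall (0 : Fin s → ℝ) 1).of_isClosed_subset (isClosed_annulus _ _)
      (annulus_subset_closedBall _ _)).image_of_continuousOn ((continuousOn s j).mono (annulus_subset_closedBall _ _))
  have hK2 : IsCompact (map s j '' closedBall (0 : Fin s → ℝ) 2⁻¹ : Set X) :=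
    (isCompact_closedBall _ _).image_of_continuousOn ((continuousOn s j).mono (closedBall_subset_closedBall (by norm_num)))
  have hO1 : IsOpen ((fun w : Cl p j => p w.1) ⁻¹' (map s j '' annulus rad 1)ᶜ) := hK1.isClosed.isOpen_compl.preimage hpc
  have hO2 : IsOpen ((fun w : Cl p j => p w.1) ⁻¹' (map s j '' closedBall (0 : Fin s → ℝ) 2⁻¹)ᶜ) :=
    hK2.isClosed.isOpen_compl.preimage hpc
  refine eq_univ_of_forall fun w => ?_
  obtain ⟨y, hy1, hyw⟩ : p w.1 ∈ closedCell s j := w.2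
  have hy1' : ‖y‖ ≤ 1 := mem_closedBall_zero_iff.1 hy1
  by_cases hlt : ‖y‖ < rad
  · -- `w` lies in the interior of `T`
    refine Or.inr (interior_maximal (fun (w' : Cl p j) (hw' : p w'.1 ∈ (map s j '' annulus rad 1)ᶜ) => ?_) hO1 ?_)
    · obtain ⟨y', hy'1, hy'w⟩ : p w'.1 ∈ closedCell s j := w'.2
      show p w'.1 ∈ map s j '' closedBall (0 : Fin s → ℝ) rad
      exact ⟨y', mem_closedBall_zero_iff.2 (le_of_not_gt fun hlt' => hw' ⟨y', ⟨hlt'.le, mem_closedBall_zero_iff.1 hy'1⟩, hy'w⟩), hy'w⟩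
    · rintro ⟨y', ⟨hy'1, hy'2⟩, hy'w⟩
      have := eq_of_map_eq_map_of_norm_lt (hlt.trans rad_lt_one) hy'2 (hy'w.trans hyw.symm)
      rw [this] at hy'1
      exact absurd hy'1 (not_le.2 hlt)
  · -- `w` lies in the interior of `p⁻¹(ēⱼ ∩ collar)`
    refine Or.inl (interior_maximal (fun (w' : Cl p j) (hw' : p w'.1 ∈ (map s j '' closedBall (0 : Fin s → ℝ) 2⁻¹)ᶜ) =>
      show p w'.1 ∈ closedCell s j ∩ collar s from ⟨w'.2, mem_collar_of_mem_closedCell w'.2 hw'⟩) hO2 ?_)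
    rintro ⟨y', hy'1, hy'w⟩
    have hy'1' : ‖y'‖ ≤ 2⁻¹ := mem_closedBall_zero_iff.1 hy'1
    have := eq_of_map_eq_map_of_norm_lt (hy'1'.trans_lt (by norm_num)) hy1' (hyw.trans hy'w.symm)
    rw [this] at hlt
    exact hlt (hy'1'.trans_lt (by norm_num))

/-- **`Π_* : H_n(Q, Q|_{‖y‖=¾}) ≅ H_n(p⁻¹ēⱼ, p⁻¹(ēⱼ ∩ collar))`.** [cite: Spanier1981, Ch. 9, Sec. 2, Lemma 2 and Thm. 15 (a)] -/
theorem isIso_map_proj (hp : IsSerreFibration p) (R : Type uR) [CommRing R] (n : ℕ) :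
    IsIso (relativeSingularHomology.map R R (proj p j) (mapsTo_proj_QS (p := p) j) n) := by
  haveI := isIso_map_QS_QA j hp R n
  haveI := isIso_exc j hp R n
  haveI := relativeSingularHomology.isIso_map_homeomorph R R (homeoT j hp) (mapsTo_homeoT j hp) (mapsTo_homeoT_symm j hp) n
  have hfac : relativeSingularHomology.map R R (proj p j) (mapsTo_proj_QS (p := p) j) n =
      relativeSingularHomology.map R R (ContinuousMap.id (Q p j)) (mapsTo_id_of_subset (QS_subset_QA (p := p) j)) n ≫
        relativeSingularHomology.map R R (homeoT j hp : C(Q p j, ↥(T p j))) (mapsTo_homeoT j hp) n ≫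
          relativeSingularHomology.map R R (subsetIncl (T p j))
            (Set.mapsTo_preimage Subtype.val (an p j) : MapsTo _ (Subtype.val ⁻¹' an p j) (an p j)) n := by
    rw [← relativeSingularHomology.map_comp, ← relativeSingularHomology.map_comp]
    exact relativeSingularHomology.map_congr R R (by ext z; rfl) _ _ n
  rw [hfac]
  infer_instance

end Pullback

/-! ### Fibrewise maps: the lift to `Q`, the restriction to `p⁻¹ēⱼ`, the fibre over the centre -/

section Fibrewise

variable {E E' : Type u} [TopologicalSpace E] [TopologicalSpace E'] {p : E → X} {p' : E' → X}
  (j : cell (univ : Set X) s)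

omit [TopologicalSpace X] [T2Space X] [CWComplex (univ : Set X)] in
/-- A fibrewise map preserves the preimage of every sub-base. [folklore] -/
theorem mapsTo_preimage (f : C(E, E')) (hf : ∀ e, p' (f e) = p e) (S : Set X) : MapsTo f (p ⁻¹' S) (p' ⁻¹' S) :=
  fun e he => by show p' (f e) ∈ S; rw [hf]; exact he

omit [T2Space X] [CWComplex (univ : Set X)] in
/-- The restriction of a fibrewise map to the preimages of a sub-base `S`. [folklore] -/
def restrictPreimage (f : C(E, E')) (hf : ∀ e, p' (f e) = p e) (S : Set X) : C(↥(p ⁻¹' S), ↥(p' ⁻¹' S)) :=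
  ⟨fun e => ⟨f e.1, mapsTo_preimage f hf S e.2⟩, (f.continuous.comp continuous_subtype_val).subtype_mk _⟩

omit [TopologicalSpace X] [T2Space X] [CWComplex (univ : Set X)] in
/-- The formula for `restrictPreimage`. [folklore] -/
@[simp] theorem restrictPreimage_apply_coe (f : C(E, E')) (hf : ∀ e, p' (f e) = p e) (S : Set X) (e : ↥(p ⁻¹' S)) :
    (restrictPreimage f hf S e : E') = f e := rfl

omit [T2Space X] in
/-- The restriction to `p⁻¹ēⱼ` respects `p⁻¹ėⱼ`. [folklore] -/
theorem mapsTo_restrictPreimage_fr (f : C(E, E')) (hf : ∀ e, p' (f e) = p e) :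
    MapsTo (restrictPreimage f hf (closedCell s j)) (fr p j) (fr p' j) :=
  fun e he => by show p' (f e.1) ∈ cellFrontier s j; rw [hf]; exact he

/-- The restriction to `p⁻¹ēⱼ` respects `p⁻¹(ēⱼ ∩ collar)`. [folklore] -/
theorem mapsTo_restrictPreimage_an (f : C(E, E')) (hf : ∀ e, p' (f e) = p e) :
    MapsTo (restrictPreimage f hf (closedCell s j)) (an p j) (an p' j) :=
  fun e he => by show p' (f e.1) ∈ closedCell s j ∩ collar s; rw [hf]; exact he

omit [T2Space X] in
/-- The defining relation of the lifted point. [folklore] -/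
theorem liftQ_rel (f : C(E, E')) (hf : ∀ e, p' (f e) = p e) (z : Q p j) :
    cellChar j rad_le_one z.fst = p' (f z.snd) := by
  rw [hf, cellChar_apply]; exact (apply_snd j z).symm

/-- **The lift of a fibrewise map to the pullbacks**, `(y, e) ↦ (y, f e)`. [folklore] -/
def liftQ (f : C(E, E')) (hf : ∀ e, p' (f e) = p e) : C(Q p j, Q p' j) :=
  ⟨fun z => ⟨(z.fst, f z.snd), liftQ_rel j f hf z⟩,
    ((continuous_fst.comp continuous_subtype_val).prodMk
      (f.continuous.comp (continuous_snd.comp continuous_subtype_val))).subtype_mk _⟩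

omit [T2Space X] in
/-- The lift is fibrewise over the cube. [folklore] -/
theorem qmap_liftQ (f : C(E, E')) (hf : ∀ e, p' (f e) = p e) (z : Q p j) : qmap p' j (liftQ j f hf z) = qmap p j z := rfl

omit [T2Space X] in
/-- The lift respects the parts over the boundary sphere. [folklore] -/
theorem mapsTo_liftQ_QS (f : C(E, E')) (hf : ∀ e, p' (f e) = p e) : MapsTo (liftQ j f hf) (QS p j) (QS p' j) :=
  fun _ hz => hz

omit [T2Space X] in
/-- `Π' ∘ lift = (f| p⁻¹ēⱼ) ∘ Π`. [folklore] -/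
theorem proj_comp_liftQ (f : C(E, E')) (hf : ∀ e, p' (f e) = p e) :
    (proj p' j).comp (liftQ j f hf) = (restrictPreimage f hf (closedCell s j)).comp (proj p j) :=
  ContinuousMap.ext fun _ => rfl

/-- The fibre over the centre `Φⱼ 0` of the cell includes into `Q` over the centre of the ball.
[folklore] -/
def fibreIncl (p : E → X) (j : cell (univ : Set X) s) : C(↥(p ⁻¹' {map s j 0}), Q p j) :=
  ⟨fun e => ⟨(⟨0, mem_closedBall_self rad_pos.le⟩, e.1), (e.2 : p e.1 = map s j 0).symm⟩,
    (continuous_const.prodMk continuous_subtype_val).subtype_mk _⟩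

omit [T2Space X] in
/-- `lift ∘ fibreIncl = fibreIncl' ∘ (f| fibre)`. [folklore] -/
theorem liftQ_comp_fibreIncl (f : C(E, E')) (hf : ∀ e, p' (f e) = p e) :
    (liftQ j f hf).comp (fibreIncl p j) = (fibreIncl p' j).comp (restrictPreimage f hf {map s j 0}) :=
  ContinuousMap.ext fun _ => rfl

omit [T2Space X] in
/-- **The fibre over the centre includes into `Q` by a weak homotopy equivalence** (the centre is a
weakly contractible sub-base of the weakly contractible ball). [cite: Spanier1981, Ch. 9, Sec. 2, Thm. 17] -/
theorem isWeakHomotopyEquiv_fibreIncl (hp : IsSerreFibration p) : IsWeakHomotopyEquiv (fibreIncl p j) := by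
  have hfst := hp.pullback_fst (cellChar j rad_le_one)
  -- `{0} ↪ (‖y‖ ≤ ¾)` is a weak equivalence of sub-bases
  set S0 : Set ↥(closedBall (0 : Fin s → ℝ) rad) := {⟨0, mem_closedBall_self rad_pos.le⟩} with hS0
  have h0 : S0 ⊆ univ := subset_univ _
  haveI : ContractibleSpace ↥(univ : Set ↥(closedBall (0 : Fin s → ℝ) rad)) :=
    haveI := (convex_closedBall (0 : Fin s → ℝ) rad).contractibleSpace ⟨0, mem_closedBall_self rad_pos.le⟩
    (Homeomorph.Set.univ ↥(closedBall (0 : Fin s → ℝ) rad)).contractibleSpace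
  have hw : IsWeakHomotopyEquiv (subsetInclusion h0) := SerreCube.isWeakHomotopyEquiv_subsetInclusion_of_contractible h0
  have h1 := hfst.isWeakHomotopyEquiv_preimage_inclusion h0 hw
  -- identify source and target
  have hmem : ∀ z : ↥(Function.Pullback.fst ⁻¹' S0 : Set (Q p j)), p z.1.snd ∈ ({map s j 0} : Set X) := fun z => by
    have hz : z.1.fst = ⟨0, mem_closedBall_self rad_pos.le⟩ := z.2
    show p z.1.snd = map s j 0
    rw [apply_snd j z.1, hz]
  let eF : ↥(p ⁻¹' {map s j 0}) ≃ₜ ↥(Function.Pullback.fst ⁻¹' S0 : Set (Q p j)) :=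
    { toFun := fun e => ⟨fibreIncl p j e, rfl⟩
      invFun := fun z => ⟨z.1.snd, hmem z⟩
      left_inv := fun e => rfl
      right_inv := fun z => by
        apply Subtype.ext; apply Subtype.ext; apply Prod.ext
        · exact (z.2 : z.1.fst = _).symm
        · rfl
      continuous_toFun := (fibreIncl p j).continuous.subtype_mk _
      continuous_invFun := ((continuous_snd.comp continuous_subtype_val).comp continuous_subtype_val).subtype_mk hmem }
  let eU : ↥(Function.Pullback.fst ⁻¹' (univ : Set ↥(closedBall (0 : Fin s → ℝ) rad)) : Set (Q p j)) ≃ₜ Q p j :=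
    Homeomorph.Set.univ (Q p j)
  have hfac : fibreIncl p j = ((eU : C(↥(Function.Pullback.fst ⁻¹' (univ : Set ↥(closedBall (0 : Fin s → ℝ) rad)) : Set (Q p j)), Q p j)).comp
      (subsetInclusion (preimage_mono h0))).comp
        (eF : C(↥(p ⁻¹' {map s j 0}), ↥(Function.Pullback.fst ⁻¹' S0 : Set (Q p j)))) :=
    ContinuousMap.ext fun _ => rfl
  rw [hfac]
  exact ((IsWeakHomotopyEquiv.of_homeomorph eU).comp h1).comp (IsWeakHomotopyEquiv.of_homeomorph eF)

end Fibrewise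

/-! ### The theorems -/

section Main

variable (R : Type uR) [CommRing R]
variable {E E' : Type u} [TopologicalSpace E] [TopologicalSpace E'] {p : E → X} {p' : E' → X}
  (j : cell (univ : Set X) s)

/-- **`H_n(p⁻¹ēⱼ, p⁻¹ėⱼ; R) = 0` for `n < s`** for a Serre fibration over a Hausdorff CW complex.
[cite: Spanier1981, Ch. 9, Sec. 2, Thm. 15 (a)] -/
theorem isZero_of_lt (hp : IsSerreFibration p) {n : ℕ} (hn : n < s) :
    IsZero (relativeSingularHomology R R (Cl p j) (fr p j) n) := by
  haveI := Serre.isIso_b R hp j n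
  haveI := isIso_map_proj j hp R n
  have hz : IsZero (relativeSingularHomology R R (Q p j) (QS p j) n) :=
    SerreCube.isZero_aux R s (isSerreFibration_qmap j hp) (qmap_preimage_boundary (p := p) j).symm n hn
  have hz' : IsZero (relativeSingularHomology R R (Cl p j) (an p j) n) :=
    hz.of_iso (asIso (relativeSingularHomology.map R R (proj p j) (mapsTo_proj_QS (p := p) j) n)).symm
  exact hz'.of_iso (asIso (relativeSingularHomology.map R R (ContinuousMap.id (Cl p j)) (mapsTo_id_of_subset (fr_subset_an j)) n))

variable (f : C(E, E')) (hf : ∀ e, p' (f e) = p e)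

/-- The auxiliary conjunction of the three transfers. [cite: Spanier1981, Ch. 9, Sec. 2, Thm. 15 (a)] -/
theorem transfer_aux (hp : IsSerreFibration p) (hp' : IsSerreFibration p') (k : ℕ) :
    (IsIso (relativeSingularHomology.map R R (restrictPreimage f hf (closedCell s j)) (mapsTo_restrictPreimage_fr j f hf) (k + s)) ↔
      IsIso (singularHomology.map R R (restrictPreimage f hf {map s j 0}) k)) ∧
    (Epi (relativeSingularHomology.map R R (restrictPreimage f hf (closedCell s j)) (mapsTo_restrictPreimage_fr j f hf) (k + s)) ↔
      Epi (singularHomology.map R R (restrictPreimage f hf {map s j 0}) k)) ∧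
    (Mono (relativeSingularHomology.map R R (restrictPreimage f hf (closedCell s j)) (mapsTo_restrictPreimage_fr j f hf) (k + s)) ↔
      Mono (singularHomology.map R R (restrictPreimage f hf {map s j 0}) k)) := by
  -- (1) `(Cl, fr) → (Cl, an)` along `b`
  haveI := Serre.isIso_b R hp j (k + s)
  haveI := Serre.isIso_b R hp' j (k + s)
  have sq1 : relativeSingularHomology.map R R (restrictPreimage f hf (closedCell s j)) (mapsTo_restrictPreimage_fr j f hf) (k + s) ≫
      relativeSingularHomology.map R R (ContinuousMap.id (Cl p' j)) (mapsTo_id_of_subset (fr_subset_an j)) (k + s) =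
      relativeSingularHomology.map R R (ContinuousMap.id (Cl p j)) (mapsTo_id_of_subset (fr_subset_an j)) (k + s) ≫
        relativeSingularHomology.map R R (restrictPreimage f hf (closedCell s j)) (mapsTo_restrictPreimage_an j f hf) (k + s) := by
    rw [← relativeSingularHomology.map_comp, ← relativeSingularHomology.map_comp]; rfl
  -- (2) `(Q, QS) → (Cl, an)` along `Π`
  haveI := isIso_map_proj j hp R (k + s)
  haveI := isIso_map_proj j hp' R (k + s)
  have sq2 : relativeSingularHomology.map R R (liftQ j f hf) (mapsTo_liftQ_QS j f hf) (k + s) ≫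
      relativeSingularHomology.map R R (proj p' j) (mapsTo_proj_QS (p := p') j) (k + s) =
      relativeSingularHomology.map R R (proj p j) (mapsTo_proj_QS (p := p) j) (k + s) ≫
        relativeSingularHomology.map R R (restrictPreimage f hf (closedCell s j)) (mapsTo_restrictPreimage_an j f hf) (k + s) := by
    rw [← relativeSingularHomology.map_comp, ← relativeSingularHomology.map_comp]
    exact relativeSingularHomology.map_congr R R (proj_comp_liftQ j f hf) _ _ (k + s)
  -- (3) the cube theorem for the lifts
  have e3 := SerreCube.main_aux R s (isSerreFibration_qmap j hp) (isSerreFibration_qmap j hp') (liftQ j f hf)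
    (qmap_liftQ j f hf) (qmap_preimage_boundary (p := p) j).symm (qmap_preimage_boundary (p := p') j).symm
    (mapsTo_liftQ_QS j f hf) k
  -- (4) the fibres include into `Q` by weak equivalences
  haveI := isIso_singularHomology_map_of_isWeakHomotopyEquiv (R := R) (fibreIncl p j) (isWeakHomotopyEquiv_fibreIncl j hp) k
  haveI := isIso_singularHomology_map_of_isWeakHomotopyEquiv (R := R) (fibreIncl p' j) (isWeakHomotopyEquiv_fibreIncl j hp') k
  have sq4 : singularHomology.map R R (restrictPreimage f hf {map s j 0}) k ≫ singularHomology.map R R (fibreIncl p' j) k =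
      singularHomology.map R R (fibreIncl p j) k ≫ singularHomology.map R R (liftQ j f hf) k := by
    rw [← singularHomology.map_comp, ← singularHomology.map_comp, liftQ_comp_fibreIncl]
  refine ⟨?_, ?_, ?_⟩
  · exact ((SerreCube.isIso_iff_of_square _ _ sq1).trans ((SerreCube.isIso_iff_of_square _ _ sq2).symm.trans
      e3.1.symm)).trans (SerreCube.isIso_iff_of_square _ _ sq4).symm
  · exact ((SerreCube.epi_iff_of_square _ _ sq1).trans ((SerreCube.epi_iff_of_square _ _ sq2).symm.trans
      e3.2.1.symm)).trans (SerreCube.epi_iff_of_square _ _ sq4).symm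
  · exact ((SerreCube.mono_iff_of_square _ _ sq1).trans ((SerreCube.mono_iff_of_square _ _ sq2).symm.trans
      e3.2.2.symm)).trans (SerreCube.mono_iff_of_square _ _ sq4).symm

/-- **Spanier's Thm. 9.2.15 (a) for Serre fibrations, naturality form — isomorphisms.** For a
fibrewise map `f` of Serre fibrations over a Hausdorff CW complex and an `s`-cell `eⱼ`,
`f_* : H_{k+s}(p⁻¹ēⱼ, p⁻¹ėⱼ) → H_{k+s}(p'⁻¹ēⱼ, p'⁻¹ėⱼ)` is an isomorphism iff
`f_* : H_k(p⁻¹(Φⱼ0)) → H_k(p'⁻¹(Φⱼ0))` is. [cite: Spanier1981, Ch. 9, Sec. 2, Thm. 15 (a)] -/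
theorem isIso_map_iff (hp : IsSerreFibration p) (hp' : IsSerreFibration p') (k : ℕ) :
    IsIso (relativeSingularHomology.map R R (restrictPreimage f hf (closedCell s j)) (mapsTo_restrictPreimage_fr j f hf) (k + s)) ↔
      IsIso (singularHomology.map R R (restrictPreimage f hf {map s j 0}) k) :=
  (transfer_aux R j f hf hp hp' k).1

/-- **Spanier's Thm. 9.2.15 (a) for Serre fibrations, naturality form — epimorphisms.**
[cite: Spanier1981, Ch. 9, Sec. 2, Thm. 15 (a)] -/
theorem epi_map_iff (hp : IsSerreFibration p) (hp' : IsSerreFibration p') (k : ℕ) :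
    Epi (relativeSingularHomology.map R R (restrictPreimage f hf (closedCell s j)) (mapsTo_restrictPreimage_fr j f hf) (k + s)) ↔
      Epi (singularHomology.map R R (restrictPreimage f hf {map s j 0}) k) :=
  (transfer_aux R j f hf hp hp' k).2.1

/-- **Spanier's Thm. 9.2.15 (a) for Serre fibrations, naturality form — monomorphisms.**
[cite: Spanier1981, Ch. 9, Sec. 2, Thm. 15 (a)] -/
theorem mono_map_iff (hp : IsSerreFibration p) (hp' : IsSerreFibration p') (k : ℕ) :
    Mono (relativeSingularHomology.map R R (restrictPreimage f hf (closedCell s j)) (mapsTo_restrictPreimage_fr j f hf) (k + s)) ↔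
      Mono (singularHomology.map R R (restrictPreimage f hf {map s j 0}) k) :=
  (transfer_aux R j f hf hp hp' k).2.2

end Main

end SerreCell

end Literature.AlgebraicTopology.Homotopy

end
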